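import Summits.QuantumFields.GaugeBoot.TiltedBoxLimitClass
import Summits.QuantumFields.GaugeBoot.TiltedBoxLimitAntiDiagonalRP
import Summits.QuantumFields.GaugeBoot.TiltedBoxLimitDLR
import Summits.QuantumFields.GaugeBoot.TiltedBoxLimitPermutations
import HarnessLib

/-!
# Infinite-volume limit points of the 45°-tilted boxes, part 13: summary statement

HONEST FRAMING (cell `pub-gaugeboot`, page 1 of every file): the venture produces certified bounds
on lattice expectations at stated coupling, gauge group, dimension and torus size; NOT a mass gap,
NOT a continuum limit, NOT a string tension; NOT Yang–Mills-summit-bearing (barriers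
`FixedCouplingUltralocality`, `PerturbativeInvisibility`). One conjunction of the results of parts
1–12, for citation; nothing new is proved.

## Content

**`tiltedBoxLimitPoint_summary`.** For a compact Hausdorff second countable gauge group `G`, a
continuous representation `ρ`, a coupling `β ≥ 0`, a dimension `d` and two axes `i ≠ j`: the set
`tiltedBoxLimitPoints d i j ρ β` of infinite-volume limit points of the Wilson states of the square
45°-tilted boxes `ℤ^d/Γ(M+2, M+2, 2(Q+2))` (`M, Q → ∞`) is NON-EMPTY, and every member `μ` is

1. a translation-invariant infinite-volume Gibbs (DLR) state of the Wilson action, `μ ∈ 𝒢_θ(β)`,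
   obeying the one-link Haar-shift identity (the loop-equation axiom);
2. invariant under the axis transposition `(i j)`, under the transpositions `(k l)` of transverse axes
   `k, l ∉ {i, j}`, and under every coordinate reflection `x_m ↦ -x_m`;
3. reflection positive in the diagonal hyperplane `x_i = x_j`, in the anti-diagonal hyperplane
   `x_i + x_j = 0`, and in the site and link hyperplanes `x_k = 0`, `x_k = ½` for every `k ∉ {i, j}`.

So a loop-equation SDP certificate using Gram blocks, the symmetries (2) and the positivity blocks
`R_diag(i,j)`, `R_antidiag(i,j)`, `R_site(k)`, `R_link(k)` (`k ∉ {i, j}`) is an exact theorem about a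
non-empty, unconditionally defined class of infinite-volume Wilson states at every `β ≥ 0` — and about
every Class-B state (`TiltedClassState.bound_transfer`); under uniqueness of the translation-invariant
Gibbs state the class is `{that state}` and coincides with the cubic-torus limit points
(`tiltedBoxLimitPoints_eq_infiniteVolumeLimitPoints_of_subsingleton_TI`), which are then Class B
(`thermodynamicLimitIsClassB_of_subsingleton_TI`). NOT included (open here): site/link RP along
`i`, `j`, diagonal RP in other planes, permutations moving `{i, j}`.

References: J. Fröhlich, R. Israel, E. H. Lieb, B. Simon, J. Stat. Phys. 22 (1980) 297, §3;
K. Osterwalder, E. Seiler, Ann. Phys. 110 (1978) 440, §2; H.-O. Georgii (2011) Thm. 4.17;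
V. Kazakov, Z. Zheng, arXiv:2203.11360 §3.1, arXiv:2404.16925 §3.2.
-/

noncomputable section

open MeasureTheory
open Literature.MathematicalPhysics.QuantumLattice

namespace Summit.QuantumFields.GaugeBoot

namespace TiltedRP

variable {d : ℕ} {i j : Fin d} {N : ℕ}
variable {G : Type*} [Group G] [TopologicalSpace G] [IsTopologicalGroup G] [CompactSpace G]
  [MeasurableSpace G] [BorelSpace G] [SecondCountableTopology G] [T2Space G]
variable (ρ : G →* Matrix (Fin N) (Fin N) ℂ)

/-- **Summary: what every tilted limit point is** (`β ≥ 0`, `i ≠ j`). See the module docstring. -/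
theorem tiltedBoxLimitPoint_summary (hij : i ≠ j) (hρ : Continuous ρ) {β : ℝ} (hβ : 0 ≤ β)
    {μ : Measure (LGConfig d G)} (hμ : μ ∈ tiltedBoxLimitPoints d i j ρ β) :
    -- (1) translation-invariant DLR state with the Haar-shift identity
    μ ∈ ymGibbsMeasuresTI ρ β ∧ IsHaarShiftState ρ β μ ∧
    -- (2) symmetries
    MeasurePreserving (configPerm (G := G) (Equiv.swap i j)) μ μ ∧
    (∀ k l : Fin d, k ≠ i → k ≠ j → l ≠ i → l ≠ j →
      MeasurePreserving (configPerm (G := G) (Equiv.swap k l)) μ μ) ∧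
    (∀ m : Fin d, MeasurePreserving (configSiteReflect (G := G) m) μ μ) ∧
    -- (3) reflection positivities
    IsReflectionPositiveFor (configDiagSwapZd (G := G) i j) (diagHalfEdges i j) μ ∧
    IsReflectionPositiveFor (configAntiDiagSwapZd (G := G) i j) (antiDiagHalfEdges i j) μ ∧
    (∀ k : Fin d, k ≠ i → k ≠ j →
      IsReflectionPositiveFor (configSiteReflect (G := G) k) (siteHalfEdges k) μ ∧
      IsReflectionPositiveFor (configLinkReflect (G := G) k) (linkHalfEdges k) μ) :=
  ⟨mem_ymGibbsMeasuresTI_of_mem_tiltedBoxLimitPoints ρ hρ hμ,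
    isHaarShiftState_of_mem_tiltedBoxLimitPoints ρ hρ hμ,
    measurePreserving_configPerm_swap_of_mem_tiltedBoxLimitPoints ρ hij hρ hμ,
    fun _ _ hki hkj hli hlj =>
      measurePreserving_configPerm_swap_transverse_of_mem_tiltedBoxLimitPoints ρ hki hkj hli hlj hρ hμ,
    reflectInvariant_of_mem_tiltedBoxLimitPoints ρ hij hρ hμ,
    diagRP_of_mem_tiltedBoxLimitPoints ρ hij hρ hβ hμ,
    antiDiagRP_of_mem_tiltedBoxLimitPoints ρ hij hρ hβ hμ,
    fun _ hki hkj => ⟨siteRP_of_mem_tiltedBoxLimitPoints ρ hki hkj hij hρ hβ hμ,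
      linkRP_of_mem_tiltedBoxLimitPoints ρ hki hkj hρ hβ hμ⟩⟩

/-- **The class is non-empty** (restated next to the summary): for every real `β` there is a tilted
limit point. -/
theorem exists_tiltedBoxLimitPoint (hρ : Continuous ρ) (β : ℝ) :
    ∃ μ : Measure (LGConfig d G), μ ∈ tiltedBoxLimitPoints d i j ρ β :=
  tiltedBoxLimitPoints_nonempty hρ β

/-- **Under uniqueness of the translation-invariant Gibbs state the unique state has all of it**:
if `|𝒢_θ(β)| ≤ 1` (`β ≥ 0`, `i ≠ j`), every cubic-torus limit point enjoys properties (1)–(3) of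
`tiltedBoxLimitPoint_summary` for the plane `(i, j)` (it is a tilted limit point of that plane). -/
theorem torusLimitPoint_summary_of_subsingleton_TI (hij : i ≠ j) (hρ : Continuous ρ) {β : ℝ}
    (hβ : 0 ≤ β) (hsub : (ymGibbsMeasuresTI (d := d) ρ β).Subsingleton)
    {μ : Measure (LGConfig d G)} (hμ : μ ∈ infiniteVolumeLimitPoints (d := d) ρ β) :
    IsReflectionPositiveFor (configDiagSwapZd (G := G) i j) (diagHalfEdges i j) μ ∧
    IsReflectionPositiveFor (configAntiDiagSwapZd (G := G) i j) (antiDiagHalfEdges i j) μ := by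
  have hμ' : μ ∈ tiltedBoxLimitPoints d i j ρ β :=
    mem_tiltedBoxLimitPoints_of_subsingleton_TI ρ hρ hsub hμ
  exact ⟨diagRP_of_mem_tiltedBoxLimitPoints ρ hij hρ hβ hμ',
    antiDiagRP_of_mem_tiltedBoxLimitPoints ρ hij hρ hβ hμ'⟩

end TiltedRP

end Summit.QuantumFields.GaugeBoot
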